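import Literature.IUT.HodgeTheaters.PuncturedEllipticProLModel
import Literature.IUT.HodgeTheaters.PuncturedEllipticCoveringsCusps
import Literature.IUT.HodgeTheaters.PuncturedEllipticArrowModelLift
import HarnessLib

/-!
# An infinite pro-`l` model of [IUTchI] §1, part 2: subgroups, cusps and the `PuncturedEllipticData`

Mochizuki, *Inter-universal Teichmüller theory I*, kurims manuscript (May 2020), §1 pp. 37–38
([IUTchI] §1 p.37) [claim: Mochizuki2012, status: disputed] (D-0012 claim key; series status DISPUTED —
WITNESS-class MODEL module; nothing of the series is asserted, no side is taken on [IUTchIII] Cor. 3.12).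

Part 1 (`PuncturedEllipticProLModel.lean`, abc-iut-L5-d4) built the profinite group `P = N ⋊ D`,
`N = ⨁_{i ∈ ℤ/l} ℤ_l B_i`, `D = ⟨a⟩ ⋊ ⟨ι⟩ = ℤ_l ⋊ ℤ/2`, acting through `D ↠ D_l` by abc-iut-L5-t1's §1
formulas.  Here (`G_k = 1`, as in abc-iut-L5-t1's `ArrowModel.datum`):
* the subgroups `N̂ = N ⋊ 1`, `Π_X := N ⋊ ⟨a⟩` (the kernel of `P ↠ ℤ/2`, index `2`),
  `Π_C̲ := N ⋊ (⟨a^l⟩ ⋊ ⟨ι⟩)` (the preimage of `{1, s r_0} ⊆ D_l`), so `Π_X̲ = Π_X ∩ Π_C̲ = N ⋊ ⟨a^l⟩`;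
* the cusps `ℤ/l` with decomposition (= inertia) groups `D_i := ℤ_l · c_i ⊆ N` (ranges of the continuous
  homomorphisms `ℤ_l → P`, `s ↦ s·c_i`), `ε⁰, ε′, ε″, 2ε := 0, 1, −1, 2`, and the conjugation formula
  `g · (v) · g⁻¹ = (φ_g v)`, whence `g D_i g⁻¹ = D_{g·i}` for abc-iut-L5-t1's cusp permutation `cuspAct`;
* the extension `P ↠ 1` and **the datum `ProLModel.datum l h5 : PuncturedEllipticData`** (prime `l ≥ 5`),
  with the cusp action `actm : P ↠ D_l → Perm(ℤ/l)` (abc-iut-L5-t1's `cuspHom`).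
abc-iut-L5-t1's `CuspGalois` at the datum and the classical laws (`Δ_X` torsion-free,
`[Δ_X : Ker(Δ_X ↠ Δ_X^{ab} ⊗ ℤ/l)] = l²`, `ModLCuspLaws`, …) are the sequels.  HONEST LABEL: semi-synthetic model — consistency evidence for OUR typed binders
only.  No instance, no `sorry`; symbolic prime `l`.
-/

noncomputable section

namespace Literature.IUT.HodgeTheaters

namespace PuncturedEllipticData

namespace ProLModel

open DihedralGroup _root_.Topology Literature.AnabelianGeometry.AbsoluteAnabelian
open Literature.AnabelianGeometry.EtaleTheta.SettingModel
open scoped Pointwise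

variable (l : ℕ) [Fact l.Prime]

/-! ### Elements and the conjugation formula -/

/-- The element `(v, 1) ∈ N ⊆ P` attached to `v ∈ V`. [claim: Mochizuki2012, status: disputed] -/
def inN (v : V l) : P l := SemidirectProduct.inl (Multiplicative.ofAdd v)

/-- [claim: Mochizuki2012, status: disputed] -/
@[simp] theorem inN_right (v : V l) : (inN l v).right = 1 := rfl

/-- [claim: Mochizuki2012, status: disputed] -/
@[simp] theorem inN_left (v : V l) : (inN l v).left = Multiplicative.ofAdd v := rfl

/-- `inN` is additive-to-multiplicative. [claim: Mochizuki2012, status: disputed] -/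
theorem inN_add (v w : V l) : inN l (v + w) = inN l v * inN l w := by
  unfold inN; rw [ofAdd_add, map_mul]

/-- `inN` is injective. [claim: Mochizuki2012, status: disputed] -/
theorem inN_injective : Function.Injective (inN l) := fun _ _ h =>
  Multiplicative.ofAdd.injective (SemidirectProduct.inl_injective h)

/-- **Conjugation formula**: `g · inl(x) · g⁻¹ = inl(φ_{g.right} x)` (`N` is abelian).
[claim: Mochizuki2012, status: disputed] -/
theorem conj_inl (g : P l) (x : N l) :
    g * SemidirectProduct.inl x * g⁻¹ = SemidirectProduct.inl (phi l g.right x) := by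
  refine SemidirectProduct.ext ?_ ?_
  · simp only [SemidirectProduct.mul_left, SemidirectProduct.mul_right, SemidirectProduct.inv_left,
      SemidirectProduct.left_inl, SemidirectProduct.right_inl, mul_one, map_inv, MulAut.apply_inv_self,
      mul_inv_cancel_comm]
  · simp only [SemidirectProduct.mul_right, SemidirectProduct.inv_right, SemidirectProduct.right_inl,
      mul_one, mul_inv_cancel]

/-- `g · (v) · g⁻¹ = (dact (toDih g.right) v)`. [claim: Mochizuki2012, status: disputed] -/
theorem conj_inN (g : P l) (v : V l) :
    g * inN l v * g⁻¹ = inN l (dact l (toDih l g.right) v) := by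
  unfold inN; rw [conj_inl]; rfl

/-- `MulAut.conj g ∘ inl = inl ∘ φ_{g.right}` as homomorphisms `N → P`. [claim: Mochizuki2012, status: disputed] -/
theorem conj_comp_inl (g : P l) :
    (MulAut.conj g).toMonoidHom.comp (SemidirectProduct.inl : N l →* P l) =
      (SemidirectProduct.inl : N l →* P l).comp (phi l g.right).toMonoidHom :=
  MonoidHom.ext fun x => conj_inl l g x

/-! ### The subgroups `N̂`, `Π_X`, `Π_C̲` -/

/-- `N̂ = N ⋊ 1 ⊆ P` (the elements with trivial `D`-component). [claim: Mochizuki2012, status: disputed] -/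
def Nhat : Subgroup (P l) := (SemidirectProduct.rightHom (N := N l) (φ := phi l)).ker

/-- [claim: Mochizuki2012, status: disputed] -/
theorem mem_Nhat_iff (g : P l) : g ∈ Nhat l ↔ g.right = 1 := by
  unfold Nhat; rw [MonoidHom.mem_ker, SemidirectProduct.rightHom_eq_right]

/-- `inN v ∈ N̂`. [claim: Mochizuki2012, status: disputed] -/
theorem inN_mem_Nhat (v : V l) : inN l v ∈ Nhat l := (mem_Nhat_iff l _).mpr rfl

/-- The `ℤ/2`-component `P → D → ℤ/2`, `g ↦ (exponent of ι)`. [claim: Mochizuki2012, status: disputed] -/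
def sgn : P l →* Z2 := SemidirectProduct.rightHom.comp SemidirectProduct.rightHom

/-- [claim: Mochizuki2012, status: disputed] -/
@[simp] theorem sgn_apply (g : P l) : sgn l g = g.right.right := rfl

/-- `sgn` is surjective (`ι ↦ ι`). [claim: Mochizuki2012, status: disputed] -/
theorem sgn_surjective : Function.Surjective (sgn l) := fun t =>
  ⟨SemidirectProduct.inr (SemidirectProduct.inr t), rfl⟩

/-- `sgn` is continuous. [claim: Mochizuki2012, status: disputed] -/
theorem continuous_sgn : Continuous (sgn l) :=
  (Semidirect.continuous_right (isInducing_D l)).comp (continuous_left_right_P l).2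

/-- **`Π_X := N ⋊ ⟨a⟩`** = `Ker(P ↠ ℤ/2)`. [claim: Mochizuki2012, status: disputed] -/
def PiXm : Subgroup (P l) := (sgn l).ker

/-- [claim: Mochizuki2012, status: disputed] -/
theorem mem_PiXm_iff (g : P l) : g ∈ PiXm l ↔ g.right.right = 1 := by
  unfold PiXm; rw [MonoidHom.mem_ker, sgn_apply]

/-- `[P : Π_X] = 2`. [claim: Mochizuki2012, status: disputed] -/
theorem index_PiXm : (PiXm l).index = 2 := by
  unfold PiXm
  rw [Subgroup.index_ker, MonoidHom.range_eq_top.mpr (sgn_surjective l), Subgroup.card_top]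
  simp

/-- `Π_X` is open (kernel of a continuous map to a discrete group). [claim: Mochizuki2012, status: disputed] -/
theorem isOpen_PiXm : IsOpen (PiXm l : Set (P l)) := by
  haveI : DiscreteTopology Z2 := inferInstanceAs (DiscreteTopology (ZMod 2))
  have : (PiXm l : Set (P l)) = sgn l ⁻¹' {1} := by
    ext g; rw [SetLike.mem_coe, mem_PiXm_iff]; rfl
  rw [this]
  exact (isOpen_discrete _).preimage (continuous_sgn l)

/-- `{1, s r_0} ⊆ D_l` (the image of `Π_C̲`; abc-iut-L5-t1's `Π_C̲ = N ⋊ ⟨s⟩`). [claim: Mochizuki2012, status: disputed] -/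
def dihCbar : Subgroup (DihedralGroup l) where
  carrier := {d | d = 1 ∨ d = sr 0}
  mul_mem' := by
    rintro d e (hd | hd) (he | he) <;>
      simp only [Set.mem_setOf_eq, hd, he, one_mul, mul_one, sr_mul_sr, sub_self, r_zero, true_or, or_true]
  one_mem' := Or.inl rfl
  inv_mem' := by
    rintro d (hd | hd)
    · exact Or.inl (by rw [hd, inv_one])
    · exact Or.inr (by rw [hd, inv_sr])

/-- [claim: Mochizuki2012, status: disputed] -/
theorem mem_dihCbar_iff (d : DihedralGroup l) : d ∈ dihCbar l ↔ d = 1 ∨ d = sr 0 := Iff.rfl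

/-- The composite `P ↠ D ↠ D_l`. [claim: Mochizuki2012, status: disputed] -/
def toDihP : P l →* DihedralGroup l := (toDih l).comp SemidirectProduct.rightHom

/-- [claim: Mochizuki2012, status: disputed] -/
@[simp] theorem toDihP_apply (g : P l) : toDihP l g = toDih l g.right := rfl

/-- `P ↠ D_l` is locally constant. [claim: Mochizuki2012, status: disputed] -/
theorem isLocallyConstant_toDihP : IsLocallyConstant (toDihP l) :=
  (isLocallyConstant_toDih l).comp_continuous (continuous_left_right_P l).2

/-- **`Π_C̲ := N ⋊ (⟨a^l⟩ ⋊ ⟨ι⟩)`** = the preimage of `{1, s r_0}` under `P ↠ D_l`. [claim: Mochizuki2012, status: disputed] -/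
def PiCbarm : Subgroup (P l) := (dihCbar l).comap (toDihP l)

/-- [claim: Mochizuki2012, status: disputed] -/
theorem mem_PiCbarm_iff (g : P l) : g ∈ PiCbarm l ↔ toDih l g.right = 1 ∨ toDih l g.right = sr 0 := Iff.rfl

/-- `Π_C̲` is open. [claim: Mochizuki2012, status: disputed] -/
theorem isOpen_PiCbarm : IsOpen (PiCbarm l : Set (P l)) :=
  isLocallyConstant_toDihP l (dihCbar l : Set (DihedralGroup l))

/-- On `Π_X` the map `P ↠ D_l` is the rotation `r_{s mod l}` of the `⟨a⟩`-coordinate. [claim: Mochizuki2012, status: disputed] -/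
theorem toDih_right_of_mem_PiXm {g : P l} (hg : g ∈ PiXm l) :
    toDih l g.right = r (PadicInt.toZMod (Multiplicative.toAdd g.right.left)) := by
  rw [toDih_apply, (mem_PiXm_iff l g).1 hg, expo_one, pow_zero, mul_one]

/-- `Π_X ∩ Π_C̲ = Π_X̲`: its elements map to `1 ∈ D_l`. [claim: Mochizuki2012, status: disputed] -/
theorem toDih_right_of_mem_PiXbar {g : P l} (hX : g ∈ PiXm l) (hC : g ∈ PiCbarm l) :
    toDih l g.right = 1 := by
  rcases (mem_PiCbarm_iff l g).1 hC with h | h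
  · exact h
  · rw [toDih_right_of_mem_PiXm l hX] at h; cases h

/-- An element of `Π_C̲` outside `Π_X` maps to `s r_0 ∈ D_l`. [claim: Mochizuki2012, status: disputed] -/
theorem toDih_right_of_mem_PiCbarm_not_PiXm {c : P l} (hC : c ∈ PiCbarm l) (hX : c ∉ PiXm l) :
    toDih l c.right = sr 0 := by
  rcases (mem_PiCbarm_iff l c).1 hC with h | h
  · exfalso; apply hX
    rw [mem_PiXm_iff]
    have ht : expo c.right.right < 2 := (Multiplicative.toAdd c.right.right).val_lt
    rw [toDih_apply] at h
    interval_cases hc : expo c.right.right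
    · have : Multiplicative.toAdd c.right.right = 0 := (ZMod.val_eq_zero _).1 hc
      exact toAdd_eq_zero.mp this
    · rw [pow_one, r_mul_sr] at h; cases h
  · exact h

/-- `N̂ ≤ Π_X ∩ Π_C̲`. [claim: Mochizuki2012, status: disputed] -/
theorem Nhat_le : Nhat l ≤ PiXm l ⊓ PiCbarm l := fun g hg => by
  rw [mem_Nhat_iff] at hg
  refine ⟨(mem_PiXm_iff l g).2 (by rw [hg]; rfl), Or.inl (by rw [toDihP_apply, hg, map_one])⟩

/-! ### The cusps: inertia groups `D_i = ℤ_l · c_i` and the cusp action -/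

/-- `ℤ_l → P`, `s ↦ (s · c_i, 1)`: the inertia group of the cusp `i` as a one-parameter subgroup.
[claim: Mochizuki2012, status: disputed] -/
def inertiaHom (i : ZMod l) : C l →* P l where
  toFun s := inN l (Multiplicative.toAdd s • cvec l i)
  map_one' := by rw [toAdd_one, zero_smul]; rfl
  map_mul' s u := by rw [toAdd_mul, add_smul, inN_add]

/-- [claim: Mochizuki2012, status: disputed] -/
theorem inertiaHom_apply (i : ZMod l) (s : C l) :
    inertiaHom l i s = inN l (Multiplicative.toAdd s • cvec l i) := rfl

/-- `s ↦ (s·c_i, 1)` is continuous. [claim: Mochizuki2012, status: disputed] -/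
theorem continuous_inertiaHom (i : ZMod l) : Continuous (inertiaHom l i) := by
  refine (continuous_inl_inr_P l).1.comp (continuous_ofAdd.comp ?_)
  exact (continuous_pi fun m => continuous_toAdd.smul continuous_const)

/-- **The decomposition (= inertia) group `D_i := ℤ_l · c_i ⊆ N ⊆ P` of the cusp `i`.**
[claim: Mochizuki2012, status: disputed] -/
def Dm (i : ZMod l) : Subgroup (P l) := (inertiaHom l i).range

/-- `D_i` is closed (a continuous image of the compact `ℤ_l`). [claim: Mochizuki2012, status: disputed] -/
theorem isClosed_Dm (i : ZMod l) : IsClosed (Dm l i : Set (P l)) := by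
  haveI : CompactSpace (C l) := inferInstanceAs (CompactSpace ℤ_[l])
  exact (isCompact_range (continuous_inertiaHom l i)).isClosed

/-- `D_i ≤ N̂`. [claim: Mochizuki2012, status: disputed] -/
theorem Dm_le_Nhat (i : ZMod l) : Dm l i ≤ Nhat l := by
  rintro _ ⟨s, rfl⟩; exact inN_mem_Nhat l _

/-- `dact` is `ℤ_l`-linear. [claim: Mochizuki2012, status: disputed] -/
theorem dact_smul (d : DihedralGroup l) (s : ℤ_[l]) (v : V l) : dact l d (s • v) = s • dact l d v := by
  funext m; cases d <;> simp [mul_neg]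

/-- **`g D_i g⁻¹ = D_{g·i}`** for abc-iut-L5-t1's cusp permutation `cuspAct`. [claim: Mochizuki2012, status: disputed] -/
theorem conj_smul_Dm (g : P l) (i : ZMod l) :
    MulAut.conj g • Dm l i = Dm l (ArrowModel.cuspAct l (toDih l g.right) i) := by
  have key : ∀ s : C l, MulAut.conj g • inertiaHom l i s =
      inertiaHom l (ArrowModel.cuspAct l (toDih l g.right) i) s := fun s => by
    rw [MulAut.smul_def, MulAut.conj_apply, inertiaHom_apply, inertiaHom_apply, conj_inN, dact_smul, dact_cvec]
  ext x
  rw [Subgroup.mem_smul_pointwise_iff_exists]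
  constructor
  · rintro ⟨y, ⟨s, rfl⟩, rfl⟩
    exact ⟨s, (key s).symm⟩
  · rintro ⟨s, rfl⟩
    exact ⟨inertiaHom l i s, ⟨s, rfl⟩, key s⟩

/-- The cusp action of `P`, through `P ↠ D_l → Perm(ℤ/l)` (abc-iut-L5-t1's `cuspHom`). [claim: Mochizuki2012, status: disputed] -/
def actm : P l →* Equiv.Perm (ZMod l) := (ArrowModel.cuspHom l).comp (toDihP l)

/-- [claim: Mochizuki2012, status: disputed] -/
theorem actm_apply (g : P l) (i : ZMod l) : actm l g i = ArrowModel.cuspAct l (toDih l g.right) i := rfl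

/-- `c_i ≠ s · c_j` for `i ≠ j` (`l ≥ 5`): the inertia lines are pairwise distinct. [claim: Mochizuki2012, status: disputed] -/
theorem cvec_ne_smul (h5 : 5 ≤ l) {i j : ZMod l} (hij : i ≠ j) (s : ℤ_[l]) : cvec l i ≠ s • cvec l j := by
  intro h
  have h1 : (1 : ZMod l) ≠ 0 := (ArrowModel.cusp_facts_of_five_le l h5).1
  have h2 : (2 : ZMod l) ≠ 0 := (ArrowModel.cusp_facts_of_five_le l h5).2.2.2.1
  have hii : i ≠ i + 1 := fun h' => h1 (by linear_combination -h')
  by_cases hj : i + 1 = j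
  · -- compare the coordinate `i`: `c_i(i) = −1`, `(s c_j)(i) = s([i = j+1] − [i = j]) = 0`
    have e2 := congrFun h i
    have hne1 : i ≠ j + 1 := fun h' => h2 (by rw [← hj] at h'; linear_combination -h')
    simp only [cvec_apply, Pi.smul_apply, smul_eq_mul, if_neg hii, if_true, if_neg hne1, if_neg hij,
      sub_self, mul_zero] at e2
    norm_num at e2
  · -- compare the coordinate `i + 1`: `c_i(i+1) = 1`, `(s c_j)(i+1) = 0`
    have e1 := congrFun h (i + 1)
    have hne : i + 1 ≠ j + 1 := fun h' => hij (add_right_cancel h')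
    simp only [cvec_apply, Pi.smul_apply, smul_eq_mul, if_true, if_neg hii.symm, if_neg hne, if_neg hj,
      sub_self, mul_zero, sub_zero] at e1
    norm_num at e1

/-- `D_i = D_j ⇒ i = j` (`l ≥ 5`). [claim: Mochizuki2012, status: disputed] -/
theorem Dm_injective (h5 : 5 ≤ l) {i j : ZMod l} (h : Dm l i = Dm l j) : i = j := by
  by_contra hij
  have hmem : inertiaHom l i (Multiplicative.ofAdd 1) ∈ Dm l j := h ▸ ⟨_, rfl⟩
  obtain ⟨s, hs⟩ := hmem
  rw [inertiaHom_apply, inertiaHom_apply, toAdd_ofAdd, one_smul] at hs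
  exact cvec_ne_smul l h5 hij (Multiplicative.toAdd s) (inN_injective l hs).symm

/-! ### The extension `P ↠ 1` and the datum -/

/-- The trivial Galois group `G_k = 1`. [claim: Mochizuki2012, status: disputed] -/
abbrev Gal : Type := Multiplicative (ZMod 1)

/-- The augmentation `P ↠ G_k = 1`. [claim: Mochizuki2012, status: disputed] -/
def augm : arithGrp l →ₜ* ProfiniteGrp.of Gal where
  toFun _ := 1
  map_one' := rfl
  map_mul' _ _ := (mul_one _).symm
  continuous_toFun := continuous_const

/-- The extension `P ↠ G_k = 1`. [claim: Mochizuki2012, status: disputed] -/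
abbrev ext : FundamentalExtension.{0} where
  arith := arithGrp l
  gal := ProfiniteGrp.of Gal
  aug := augm l
  aug_surjective _ := ⟨1, Subsingleton.elim _ _⟩

/-- `Δ_C = P` (`G_k = 1`). [claim: Mochizuki2012, status: disputed] -/
theorem geom_eq_top : (ext l).geom = ⊤ := by
  ext x
  simp only [Subgroup.mem_top, iff_true]
  exact Subsingleton.elim _ _

/-- A prime `≥ 5` is prime to `6`. [claim: Mochizuki2012, status: disputed] -/
theorem coprime_six_of_prime (h5 : 5 ≤ l) : Nat.Coprime l 6 := by
  have hp : l.Prime := Fact.out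
  refine (Nat.Prime.coprime_iff_not_dvd hp).2 fun h => ?_
  have h6 := Nat.le_of_dvd (by norm_num) h
  interval_cases l
  · norm_num at h
  · exact Nat.not_prime_mul (a := 2) (b := 3) (by norm_num) (by norm_num) hp

/-- **The pro-`l` §1 model datum** (`l ≥ 5` prime): `Π_C = ℤ_l^{ℤ/l} ⋊ (ℤ_l ⋊ ℤ/2) ↠ 1`, `Π_X = N ⋊ ⟨a⟩`,
`Π_C̲ = N ⋊ (⟨a^l⟩ ⋊ ⟨ι⟩)`, cusps `ℤ/l` with `D_i = ℤ_l · c_i`, `c_i = B_{i+1} − B_i`, `ε⁰, ε′, ε″, 2ε := 0, 1, −1, 2`.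
([IUTchI] §1 p.37) [claim: Mochizuki2012, status: disputed] -/
abbrev datum (h5 : 5 ≤ l) : PuncturedEllipticData.{0} where
  l := l
  five_le := h5
  coprime_six := coprime_six_of_prime l h5
  E := ext l
  PiX := PiXm l
  PiCbar := PiCbarm l
  isOpen_piX := isOpen_PiXm l
  isOpen_piCbar := isOpen_PiCbarm l
  index_piX := index_PiXm l
  aug_piX := fun _ => ⟨1, Subsingleton.elim _ _⟩
  aug_piCbar := fun _ => ⟨1, Subsingleton.elim _ _⟩
  star := by
    intro g hg x hx
    have hg' : g ∈ PiXm l ⊓ (ext l).geom := ⟨hg, by rw [geom_eq_top]; trivial⟩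
    refine Subgroup.le_topologicalClosure _ (Subgroup.mem_sup_left ?_)
    rw [← commutatorElement_def]
    exact Subgroup.commutator_mem_commutator hg' hx
  Cusp := ZMod l
  decomp := Dm l
  decomp_le := fun i => (Dm_le_Nhat l i).trans (Nhat_le l)
  ε0 := 0
  ε1 := 1
  ε2 := -1
  twoε := 2
  ε1_ne_ε0 := (ArrowModel.cusp_facts_of_five_le l h5).1
  ε2_ne_ε0 := (ArrowModel.cusp_facts_of_five_le l h5).2.1
  ε1_ne_ε2 := (ArrowModel.cusp_facts_of_five_le l h5).2.2.1
  twoε_ne := (ArrowModel.cusp_facts_of_five_le l h5).2.2.2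
  aug_decomp_twoε := fun _ => ⟨1, Subsingleton.elim _ _⟩

/-- The fields of the datum, by `rfl`. [claim: Mochizuki2012, status: disputed] -/
theorem datum_unfold (h5 : 5 ≤ l) :
    (datum l h5).PiX = PiXm l ∧ (datum l h5).PiCbar = PiCbarm l ∧ (datum l h5).PiXbar = PiXm l ⊓ PiCbarm l ∧
      (datum l h5).decomp = Dm l ∧ (datum l h5).DeltaC = ⊤ ∧ (datum l h5).l = l :=
  ⟨rfl, rfl, rfl, rfl, geom_eq_top l, rfl⟩

end ProLModel

end PuncturedEllipticData

end Literature.IUT.HodgeTheaters
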